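import Literature.AlgebraicGeometry.HodgeTheory.CentreTimesCMCurveBalancedProducts
import Literature.AlgebraicGeometry.ComplexMultiplication.EndAlgebraCentralDegreeSquare
import HarnessLib

/-!
# Moonen–Zarhin 1999 case (f) for a simple THREEFOLD `X₂` with the literal hypothesis «there exists an embedding `k ↪ End⁰(X₂)`»

Family `hodge`, layer `Literature/AlgebraicGeometry/HodgeTheory`. Research context: cell `pub-hodge-ring2` (HONEST
FRAMING: research route conditional on HC_CM; not a corollary; Q11.4-sentence-2 already refuted in dim ≥ 3),
Literature lane, programme R33-B (lit gen 63). Theorems only (no definition, no named fact, D-0026); no `HC_CM`.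

PRINTED RESULT. B. Moonen, Yu. Zarhin, *Hodge classes on abelian varieties of low dimension*, Math. Ann. 315 (1999)
711–733 [held: `paper:arxiv-math_9901113`]: case (a) (chunk p0001 L77–L80) «`X_1` is an elliptic curve with complex
multiplication by an imaginary quadratic field `k` and … `X_2` is a simple abelian threefold such that there exists
an embedding `k ↪ End⁰(X_2)`»; case (f) (p0001 L132–L134) «`X` is isogenous to a product `X_0 × X_1 × X_2`, where
`X_0` is an elliptic curve, where `X_1` and `X_2` are as in (a), and such that `X_0` and `X_1` are not isogenous»;
Thm. 0.2 (2) (p0001 L157–L162) «Then `Hg(X) = Hg(X_0) × Hg(X_1 × X_2)`. For every `n ≥ 1` the Hodge ring `B•(Xⁿ)`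
is generated by the images of `B•(X_0ⁿ)` and `B•(X_1ⁿ × X_2ⁿ)`. …»; §5 (5.11) (p0010 L61–L62) «If `End⁰(Y_2)`
contains an imaginary quadratic field then this subfield is unique»; §2 (2.3) (p0005 L85–L106) «`g = 3`. There
are four cases» — `End⁰` of a simple threefold is `ℚ`, a totally real cubic field, an imaginary quadratic field
or a sextic CM field, in each case COMMUTATIVE.

WHAT IS PROVED. The tree's case (f) theorems (`CentreTimesCMCurveBalancedProducts`, R31-D) take the embedding of
`k` into the CENTRE of `End⁰(X₂)` (`w ∈ Z(End⁰ X₂)` with `w² = -d₁`, or a ring homomorphism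
`End⁰(X₁) → Z(End⁰ X₂)`), for `X₂` simple of any odd dimension. For the printed case — `X₂` a simple THREEFOLD —
`End⁰(X₂)` is commutative (Albert: `[End⁰ : ℚ] = d²e ∣ 6` forces `d = 1`; the tree's
`ComplexMultiplication.center_endAlgebra_eq_top_of_dim_eq_three`, R33), so the hypothesis is the printed one:
* §1 `forall_mul_self_ne_of_dim_eq_three` — (5.11)'s «this subfield is unique» literally on `End⁰(X₂)`: a square
  root `w` of `-d₁` and a square root `z` of `-d₀` in `End⁰` of a simple threefold force `d₀ = q²d₁`;
* §2 **`hodgeClassesProductSpan_powSucc_powSucc_caseF_of_dim_eq_three`** — sentences 1–2 of Thm. 0.2 (2) as product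
  span on all powers, hypotheses: `X₀`, `X₁` elliptic curves, `X₀ ≁ X₁`, `χ₁ ≫ χ₁ = -d₁` on `X₁`, `X₂` a simple
  threefold with an endomorphism `w`, `w ≫ w = -d₁` (the embedding `k = ℚ(√-d₁) ↪ End⁰(X₂)`); one-slot form; the
  embedding given as ANY ring homomorphism `j : End⁰(X₁) →+* End⁰(X₂)` (`…_of_ringHom'`); the Hodge conjecture for
  `X₀ × (X₁ × X₂)` from that of `X₁ × X₂` (`hodgeConjectureFor_caseF_of_dim_eq_three_of_hodgeConjectureFor`).
* §3 (appended, lit g63 R33-C) **(5.3) «Either (a1) `F = k`, or (a2) `F` is a sextic CM-field»** in degrees and CM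
  type: `End⁰` of a simple threefold is a field (`isField_endAlgebra_of_isSimple_of_dim_eq_three`); a square root of
  `-d₁` in a finite-dimensional `ℚ`-algebra forces EVEN dimension (`even_finrank_of_mul_self_eq_neg`: the
  determinant of left multiplication squares to `(-d₁)^n`), so `dim_ℚ End⁰(X₂) ∈ {2, 6}`
  (`finrank_endAlgebra_eq_two_or_eq_six_of_dim_eq_three`), and degree `6 = 2 dim X₂` means CM type
  (`isOfCMType_of_isSimple_of_dim_eq_three_of_finrank_eq_six`, Milne/Shimura); hence
  **`finrank_endAlgebra_eq_two_or_isOfCMType_of_dim_eq_three(_of_ringHom)`** — `X₂` as in (a) has `End⁰(X₂) = k`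
  or is of CM type by a sextic CM field. Helpers for the assembly of case (f): `eigenMultiplicity_neg`
  (`(-φ)^*`-multiplicity at `ρ` = `φ^*`-multiplicity at `-ρ`) and `exists_hom_comp_self_eq_neg_of_ringHom` (from
  `j : End⁰(X₁) →+* End⁰(X₂)` and `χ₁ ≫ χ₁ = -d₁`: an honest `φ : X₂ ⟶ X₂` and `M ≥ 1` with
  `φ ≫ φ = -(M²d₁) = (Mχ₁) ≫ (Mχ₁)`, `of φ = M · j(of χ₁)` — Mumford §19 Thm. 3, clearing denominators).

## References
* [MoonenZarhin1999LowDim] B. J. J. Moonen, Yu. G. Zarhin, Math. Ann. 315 (1999), 711–733; cases (a), (f),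
  Thm. 0.2 (2), §2 (2.3), §5 (5.11) (held: `paper:arxiv-math_9901113`, chunks p0001, p0005, p0010; arXiv v2 = Math. Ann. numbering — earlier tree copies wrote «(2.4)» for the `g = 3` list (2.3) and «(5.10)» for the `E × Y` paragraph (5.11)).
  [cite: MoonenZarhin1999LowDim, Thm. 0.2 (2) with case (f)]
* [MumfordAV1970] D. Mumford, *Abelian Varieties* (1970), §21 (pp. 201–202) (Albert's `e`, `d`, `ed² ∣ 2g`).
  [cite: MumfordAV1970, §21 (pp. 201–202)]
* [vanGeemen1994HodgeAV] B. van Geemen, LNM 1594 (1994), Lemma 3.7 (isogeny invariance of the Hodge conjecture).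
  [cite: vanGeemen1994HodgeAV, Lemma 3.7]
* [Milne1999] J. S. Milne, Compositio Math. 117 (1999), §2 p. 54 (CM type: a commutative semisimple subalgebra of
  degree `2 dim`). [cite: Milne1999, §2 p. 54]
-/

noncomputable section

open scoped TensorProduct
open CategoryTheory

namespace Literature.AlgebraicGeometry.HodgeTheory

open Literature.AlgebraicGeometry.Motives Literature.AlgebraicGeometry.Motives.HodgeStructure
open Literature.AlgebraicGeometry.ComplexMultiplication
open Literature.AlgebraicGeometry.Milne1999 (IsOfCMType)
open Literature.AlgebraicTopology.SingularHomology

variable {X₀ X₁ X₂ : AbelianVariety ℂ}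

/-! ### §1 (5.11): the imaginary quadratic subfield of `End⁰` of a simple threefold is unique -/

/-- **«If `End⁰(Y_2)` contains an imaginary quadratic field then this subfield is unique»** (Moonen–Zarhin §5
(5.11), `Y₂` a simple threefold), element form on ALL of `End⁰(X₂)`: if `w ∈ End⁰(X₂)` has `w² = -d₁` and `d₀ > 0`
is not of the form `q²d₁`, then no `z ∈ End⁰(X₂)` has `z² = -d₀`. `End⁰` of a simple threefold is commutative
(the tree's `center_endAlgebra_eq_top_of_dim_eq_three`), so the tree's centre version
`forall_center_mul_self_ne_of_odd_dim` applies to every element. [cite: MoonenZarhin1999LowDim, §5 (5.11) and §2 (2.3)]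
[cite: MumfordAV1970, §21 (pp. 201–202)] -/
theorem forall_mul_self_ne_of_dim_eq_three (hX₂ : X₂.IsSimple) (hX₂3 : X₂.dim = 3) {w : X₂.endAlgebra}
    {d₁ d₀ : ℕ} (hd₁ : 0 < d₁) (hd₀ : 0 < d₀) (hww : w * w = -((d₁ : ℚ) • 1))
    (hfree : ∀ q : ℚ, (d₀ : ℚ) ≠ q ^ 2 * d₁) : ∀ z : X₂.endAlgebra, z * z ≠ -((d₀ : ℚ) • 1) := by
  have htop := center_endAlgebra_eq_top_of_dim_eq_three hX₂ hX₂3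
  have hmem : ∀ u : X₂.endAlgebra, u ∈ Subalgebra.center ℚ X₂.endAlgebra := fun u => by
    rw [htop]; exact Algebra.mem_top
  intro z
  exact forall_center_mul_self_ne_of_odd_dim hX₂ (by rw [hX₂3]; decide) (hmem w) hd₁ hd₀ hww hfree z (hmem z)

/-! ### §2 Case (f) with «there exists an embedding `k ↪ End⁰(X₂)`», `X₂` a simple threefold -/

/-- **THM. 0.2 (2), CASE (f), sentences 1–2, `X₂` a simple THREEFOLD, literal hypotheses**: `X₀`, `X₁` elliptic
curves, «`X_0` and `X_1` are not isogenous», `X₁` with complex multiplication `χ₁ ≫ χ₁ = -d₁` by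
`k = ℚ(√-d₁)`, `X₂` a simple abelian threefold with an endomorphism `w`, `w ≫ w = -d₁` — «there exists an
embedding `k ↪ End⁰(X_2)`», with no centrality hypothesis (it is automatic in dimension `3`, R33). Then for every
`N` the rational Hodge classes of `(X₁ × X₂)^{N+1} × X₀^{N+1}` are spanned by exterior products of Hodge classes of
the two factors («`B•(Xⁿ)` is generated by the images of `B•(X_0ⁿ)` and `B•(X_1ⁿ × X_2ⁿ)`»).
[cite: MoonenZarhin1999LowDim, Thm. 0.2 (2) with case (f)] [cite: MumfordAV1970, §21 (pp. 201–202)] -/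
theorem hodgeClassesProductSpan_powSucc_powSucc_caseF_of_dim_eq_three (hX₀ : X₀.dim = 1) (hX₁ : X₁.dim = 1)
    (hni : ¬ AbelianVariety.IsIsogenous X₀ X₁) (χ₁ : X₁ ⟶ X₁) {d₁ : ℕ} (hd₁ : 0 < d₁)
    (hχ₁ : χ₁ ≫ χ₁ = -(d₁ • 𝟙 X₁)) (hX₂ : X₂.IsSimple) (hX₂3 : X₂.dim = 3) (w : X₂ ⟶ X₂)
    (hw : w ≫ w = -(d₁ • 𝟙 X₂)) (N : ℕ) :
    HodgeClassesProductSpan ((X₁.prod X₂).powSucc N) (X₀.powSucc N) := by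
  obtain ⟨z, hz, hzz⟩ := exists_center_mul_self_eq_neg_of_dim_eq_three hX₂ hX₂3 hw
  exact hodgeClassesProductSpan_powSucc_powSucc_caseF_of_odd hX₀ hX₁ hni χ₁ hd₁ hχ₁ hX₂ (by rw [hX₂3]; decide)
    (by omega) hz hzz N

/-- Case (f) for a simple threefold, one slot on each side and the order of the paper:
`HodgeClassesProductSpan X₀ (X₁ × X₂)` («`Hg(X) = Hg(X_0) × Hg(X_1 × X_2)`» read on classes).
[cite: MoonenZarhin1999LowDim, Thm. 0.2 (2) with case (f)] -/
theorem hodgeClassesProductSpan_caseF_of_dim_eq_three (hX₀ : X₀.dim = 1) (hX₁ : X₁.dim = 1)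
    (hni : ¬ AbelianVariety.IsIsogenous X₀ X₁) (χ₁ : X₁ ⟶ X₁) {d₁ : ℕ} (hd₁ : 0 < d₁)
    (hχ₁ : χ₁ ≫ χ₁ = -(d₁ • 𝟙 X₁)) (hX₂ : X₂.IsSimple) (hX₂3 : X₂.dim = 3) (w : X₂ ⟶ X₂)
    (hw : w ≫ w = -(d₁ • 𝟙 X₂)) : HodgeClassesProductSpan X₀ (X₁.prod X₂) := by
  obtain ⟨z, hz, hzz⟩ := exists_center_mul_self_eq_neg_of_dim_eq_three hX₂ hX₂3 hw
  exact hodgeClassesProductSpan_caseF_of_odd hX₀ hX₁ hni χ₁ hd₁ hχ₁ hX₂ (by rw [hX₂3]; decide) (by omega) hz hzz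

/-- **Case (f) with the embedding given as a ring homomorphism `j : End⁰(X₁) →+* End⁰(X₂)`** — literally «an
embedding `k ↪ End⁰(X_2)`» for `k = End⁰(X₁)` the CM field of the curve `X₁` (`χ₁ ≫ χ₁ = -d₁`), `X₂` a simple
threefold: product span on all powers. The image of `j` is central (R33
`ringHom_apply_mem_center_endAlgebra_of_dim_eq_three`), so the tree's `…_caseF_of_odd_of_ringHom` applies to the
co-restriction of `j`. [cite: MoonenZarhin1999LowDim, Thm. 0.2 (2) with case (f)] [cite: MumfordAV1970, §21 (pp. 201–202)] -/
theorem hodgeClassesProductSpan_powSucc_powSucc_caseF_of_dim_eq_three_of_ringHom (hX₀ : X₀.dim = 1)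
    (hX₁ : X₁.dim = 1) (hni : ¬ AbelianVariety.IsIsogenous X₀ X₁) (χ₁ : X₁ ⟶ X₁) {d₁ : ℕ} (hd₁ : 0 < d₁)
    (hχ₁ : χ₁ ≫ χ₁ = -(d₁ • 𝟙 X₁)) (hX₂ : X₂.IsSimple) (hX₂3 : X₂.dim = 3)
    (j : X₁.endAlgebra →+* X₂.endAlgebra) (N : ℕ) :
    HodgeClassesProductSpan ((X₁.prod X₂).powSucc N) (X₀.powSucc N) :=
  hodgeClassesProductSpan_powSucc_powSucc_caseF_of_odd_of_ringHom hX₀ hX₁ hni χ₁ hd₁ hχ₁ hX₂ (by rw [hX₂3]; decide)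
    (by omega)
    (j.codRestrict (Subalgebra.center ℚ X₂.endAlgebra).toSubring.toSubsemiring
      fun x => ringHom_apply_mem_center_endAlgebra_of_dim_eq_three hX₂ hX₂3 j x) N

/-- **The Hodge conjecture for `X₀ × (X₁ × X₂)` in case (f), `X₂` a simple threefold with `w ≫ w = -d₁`, follows
from the Hodge conjecture for `X₁ × X₂`** (product span + `B(X₀) = D(X₀)` for the curve; the tree's
`hodgeConjectureFor_caseF_of_hodgeConjectureFor` with its centre hypothesis discharged in dimension `3`).
[cite: MoonenZarhin1999LowDim, Thm. 0.2 (2) with case (f)] [cite: vanGeemen1994HodgeAV, Lemma 3.7] -/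
theorem hodgeConjectureFor_caseF_of_dim_eq_three_of_hodgeConjectureFor (hX₀ : X₀.dim = 1) (hX₁ : X₁.dim = 1)
    (hni : ¬ AbelianVariety.IsIsogenous X₀ X₁) (χ₁ : X₁ ⟶ X₁) {d₁ : ℕ} (hd₁ : 0 < d₁)
    (hχ₁ : χ₁ ≫ χ₁ = -(d₁ • 𝟙 X₁)) (hX₂ : X₂.IsSimple) (hX₂3 : X₂.dim = 3) (w : X₂ ⟶ X₂)
    (hw : w ≫ w = -(d₁ • 𝟙 X₂)) (hHC : HodgeConjectureFor (X₁.prod X₂).dim (X₁.prod X₂).X) :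
    HodgeConjectureFor (X₀.prod (X₁.prod X₂)).dim (X₀.prod (X₁.prod X₂)).X := by
  obtain ⟨z, hz, hzz⟩ := exists_center_mul_self_eq_neg_of_dim_eq_three hX₂ hX₂3 hw
  exact hodgeConjectureFor_caseF_of_odd_of_hodgeConjectureFor hX₀ hX₁ hni χ₁ hd₁ hχ₁ hX₂ (by rw [hX₂3]; decide)
    (by omega) hz hzz hHC

/-- … and for every `X` isogenous to `X₀ × X₁ × X₂` («`X` is isogenous to a product»; the Hodge conjecture is
isogeny invariant, the tree's `HodgeConjectureFor.of_isIsogenous`). [cite: MoonenZarhin1999LowDim, Thm. 0.2 (2) with case (f)]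
[cite: vanGeemen1994HodgeAV, Lemma 3.7] -/
theorem hodgeConjectureFor_of_isIsogenous_caseF_of_dim_eq_three_of_hodgeConjectureFor {X : AbelianVariety ℂ}
    (hX : AbelianVariety.IsIsogenous X (X₀.prod (X₁.prod X₂))) (hX₀ : X₀.dim = 1) (hX₁ : X₁.dim = 1)
    (hni : ¬ AbelianVariety.IsIsogenous X₀ X₁) (χ₁ : X₁ ⟶ X₁) {d₁ : ℕ} (hd₁ : 0 < d₁)
    (hχ₁ : χ₁ ≫ χ₁ = -(d₁ • 𝟙 X₁)) (hX₂ : X₂.IsSimple) (hX₂3 : X₂.dim = 3) (w : X₂ ⟶ X₂)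
    (hw : w ≫ w = -(d₁ • 𝟙 X₂)) (hHC : HodgeConjectureFor (X₁.prod X₂).dim (X₁.prod X₂).X) :
    HodgeConjectureFor X.dim X.X :=
  HodgeConjectureFor.of_isIsogenous hX
    (hodgeConjectureFor_caseF_of_dim_eq_three_of_hodgeConjectureFor hX₀ hX₁ hni χ₁ hd₁ hχ₁ hX₂ hX₂3 w hw hHC)

/-! ### §3 (5.3): «Either (a1) `F = k`, or (a2) `F` is a sextic CM-field» — degrees and CM type (appended, R33-C) -/

/-- **A square root of `-d₁` (`d₁ > 0`) in a finite-dimensional `ℚ`-algebra `D` forces `dim_ℚ D` to be EVEN**: left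
multiplication `L_w` has `L_w² = -d₁ · id`, so `det(L_w)² = (-d₁)^{dim D}`, which is negative for odd `dim D`. (The
parity behind Moonen–Zarhin's (5.3): a field `F ⊇ k = ℚ(√-d₁)` of degree dividing `6` has degree `2` or `6`.)
[cite: MoonenZarhin1999LowDim, §5 (5.3)] -/
theorem even_finrank_of_mul_self_eq_neg {D : Type*} [Ring D] [Algebra ℚ D] [Module.Finite ℚ D]
    {w : D} {d₁ : ℕ} (hd₁ : 0 < d₁) (hww : w * w = -((d₁ : ℚ) • 1)) : Even (Module.finrank ℚ D) := by
  rcases Nat.even_or_odd (Module.finrank ℚ D) with h | h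
  · exact h
  exfalso
  set L : D →ₗ[ℚ] D := LinearMap.mulLeft ℚ w with hL
  have hLL : L ∘ₗ L = (-(d₁ : ℚ)) • LinearMap.id := by
    ext x
    rw [LinearMap.comp_apply, hL, LinearMap.mulLeft_apply, LinearMap.mulLeft_apply, ← mul_assoc, hww,
      LinearMap.smul_apply, LinearMap.id_apply, neg_mul, smul_mul_assoc, one_mul, neg_smul]
  have hdet : LinearMap.det L * LinearMap.det L = (-(d₁ : ℚ)) ^ Module.finrank ℚ D := by
    rw [← LinearMap.det_comp, hLL, LinearMap.det_smul, LinearMap.det_id, mul_one]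
  have hneg : (-(d₁ : ℚ)) ^ Module.finrank ℚ D < 0 := by
    rw [h.neg_pow]
    exact neg_neg_of_pos (pow_pos (Nat.cast_pos.2 hd₁) _)
  nlinarith [mul_self_nonneg (LinearMap.det L)]

/-- **`End⁰` of a simple complex abelian threefold is a FIELD** (commutative, the tree's R33
`endAlgebra_mul_comm_of_dim_eq_three`, and a division ring, Mumford §19 Cor. 2). [cite: MoonenZarhin1999LowDim, §2 (2.3)]
[cite: MumfordAV1970, §19 Cor. 2 of Thm. 1 (p. 174)] -/
theorem isField_endAlgebra_of_isSimple_of_dim_eq_three (hX₂ : X₂.IsSimple) (hX₂3 : X₂.dim = 3) :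
    IsField X₂.endAlgebra :=
  AbelianVariety.isField_endAlgebra_of_isSimple_of_comm hX₂ (by omega) (endAlgebra_mul_comm_of_dim_eq_three hX₂ hX₂3)

/-- **Moonen–Zarhin (5.3) in degrees: `F = End⁰(X₂)` of a simple threefold containing a square root of `-d₁ < 0` has
`dim_ℚ F = 2` or `dim_ℚ F = 6`** («Either (a1) `F = k`, or (a2) `F` is a sextic CM-field»): `[F : ℚ] ∣ 2·3` (the
tree's `finrank_endAlgebra_dvd_two_mul_dim`) and `[F : ℚ]` is even (`even_finrank_of_mul_self_eq_neg`).
[cite: MoonenZarhin1999LowDim, §5 (5.3)] [cite: MumfordAV1970, §21 (pp. 201–202)] -/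
theorem finrank_endAlgebra_eq_two_or_eq_six_of_dim_eq_three (hX₂ : X₂.IsSimple) (hX₂3 : X₂.dim = 3)
    {w : X₂.endAlgebra} {d₁ : ℕ} (hd₁ : 0 < d₁) (hww : w * w = -((d₁ : ℚ) • 1)) :
    Module.finrank ℚ X₂.endAlgebra = 2 ∨ Module.finrank ℚ X₂.endAlgebra = 6 := by
  haveI : Module.Finite ℚ X₂.endAlgebra := AbelianVariety.finiteDimensional_endAlgebra_holds X₂
  have hdvd : Module.finrank ℚ X₂.endAlgebra ∣ 6 := by
    have h := finrank_endAlgebra_dvd_two_mul_dim hX₂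
    rwa [hX₂3] at h
  have heven := even_finrank_of_mul_self_eq_neg hd₁ hww
  have hpos : 0 < Module.finrank ℚ X₂.endAlgebra := Nat.pos_of_dvd_of_pos hdvd (by norm_num)
  have hle : Module.finrank ℚ X₂.endAlgebra ≤ 6 := Nat.le_of_dvd (by norm_num) hdvd
  generalize Module.finrank ℚ X₂.endAlgebra = n at hdvd heven hpos hle ⊢
  interval_cases n <;> simp_all (config := { decide := true })

/-- **Degree `6 = 2 dim X₂`: `X₂` is of CM type** («(a2) `F` is a sextic CM-field»; Moonen–Zarhin (2.3) Type IV(3,1)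
«`End⁰(X) = F` is a CM-field of degree `6` … `Hg(X) = U_F`»): the field `End⁰(X₂)` is a commutative semisimple
subalgebra of degree `2 dim X₂` (Milne's `IsOfCMType`, the tree's `isOfCMType_of_isField`).
[cite: MoonenZarhin1999LowDim, §2 (2.3) and §5 (5.3)] [cite: Milne1999, §2 p. 54] -/
theorem isOfCMType_of_isSimple_of_dim_eq_three_of_finrank_eq_six (hX₂ : X₂.IsSimple) (hX₂3 : X₂.dim = 3)
    (h6 : Module.finrank ℚ X₂.endAlgebra = 6) : IsOfCMType X₂ := by
  haveI : Module.Finite ℚ X₂.endAlgebra := AbelianVariety.finiteDimensional_endAlgebra_holds X₂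
  have hF : IsField X₂.endAlgebra := isField_endAlgebra_of_isSimple_of_dim_eq_three hX₂ hX₂3
  have hF' : IsField (⊤ : Subalgebra ℚ X₂.endAlgebra) :=
    MulEquiv.isField hF (Subalgebra.topEquiv (R := ℚ) (A := X₂.endAlgebra)).toMulEquiv
  refine isOfCMType_of_isField ⊤ hF' ?_
  rw [← Subalgebra.finrank_toSubmodule, Algebra.top_toSubmodule, finrank_top, h6, hX₂3]

/-- **(5.3): a simple threefold `X₂` with a square root of `-d₁` in `End⁰(X₂)` has `End⁰(X₂) = k` (`dim_ℚ = 2`,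
case (a1)) or is of CM type by the sextic CM field `End⁰(X₂)` (case (a2)).** [cite: MoonenZarhin1999LowDim, §5 (5.3)] -/
theorem finrank_endAlgebra_eq_two_or_isOfCMType_of_dim_eq_three (hX₂ : X₂.IsSimple) (hX₂3 : X₂.dim = 3)
    {w : X₂.endAlgebra} {d₁ : ℕ} (hd₁ : 0 < d₁) (hww : w * w = -((d₁ : ℚ) • 1)) :
    Module.finrank ℚ X₂.endAlgebra = 2 ∨ IsOfCMType X₂ :=
  (finrank_endAlgebra_eq_two_or_eq_six_of_dim_eq_three hX₂ hX₂3 hd₁ hww).imp_right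
    (isOfCMType_of_isSimple_of_dim_eq_three_of_finrank_eq_six hX₂ hX₂3)

/-- **(5.3) from the printed datum «an embedding `k ↪ End⁰(X_2)`»**, `k = End⁰(X₁)` the CM field of the curve
`X₁` (`χ₁ ≫ χ₁ = -d₁`), given as a ring homomorphism `j : End⁰(X₁) →+* End⁰(X₂)`: `dim_ℚ End⁰(X₂) = 2` or `X₂` is
of CM type. [cite: MoonenZarhin1999LowDim, §5 (5.3)] -/
theorem finrank_endAlgebra_eq_two_or_isOfCMType_of_dim_eq_three_of_ringHom (hX₂ : X₂.IsSimple)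
    (hX₂3 : X₂.dim = 3) {χ₁ : X₁ ⟶ X₁} {d₁ : ℕ} (hd₁ : 0 < d₁) (hχ₁ : χ₁ ≫ χ₁ = -(d₁ • 𝟙 X₁))
    (j : X₁.endAlgebra →+* X₂.endAlgebra) : Module.finrank ℚ X₂.endAlgebra = 2 ∨ IsOfCMType X₂ := by
  obtain ⟨w, -, hww⟩ := exists_center_mul_self_eq_neg_of_ringHom (X₂ := X₂) hχ₁
    (j.codRestrict (Subalgebra.center ℚ X₂.endAlgebra).toSubring.toSubsemiring
      fun x => ringHom_apply_mem_center_endAlgebra_of_dim_eq_three hX₂ hX₂3 j x)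
  exact finrank_endAlgebra_eq_two_or_isOfCMType_of_dim_eq_three hX₂ hX₂3 hd₁ hww

/-- **Multiplicities under `φ ↦ -φ`**: the multiplicity of `ρ` for `(-φ)^*` on `H^{1,0}(A)` is the multiplicity of
`-ρ` for `φ^*` (`(-φ)^* = -φ^*` on `H¹`, the tree's `complexBetti_map_neg_one`); Moonen–Zarhin's multiplicities
`n_σ` of the two embeddings `σ(√-d) = ± i√d` of `k` are exchanged by `φ ↦ -φ`. Standard API for the tree's
`eigenMultiplicity`. [cite: MoonenZarhin1998WeilClasses, §1 (the multiplicities n_σ)] [cite: vanGeemen1994HodgeAV, Lemma 5.2] -/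
theorem eigenMultiplicity_neg (A : AbelianVariety ℂ) (φ : A ⟶ A) (ρ : ℂ) :
    eigenMultiplicity A (-φ) ρ = eigenMultiplicity A φ (-ρ) := by
  unfold eigenMultiplicity
  have h : Module.End.eigenspace (complexBetti.map (-φ).hom.hom.hom 1).hom ρ =
      Module.End.eigenspace (complexBetti.map φ.hom.hom.hom 1).hom (-ρ) := by
    ext x
    rw [Module.End.mem_eigenspace_iff, Module.End.mem_eigenspace_iff, complexBetti_map_neg_one,
      ModuleCat.hom_neg, LinearMap.neg_apply, neg_eq_iff_eq_neg, neg_smul]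
  rw [h]

/-- **From the embedding to honest endomorphisms with one square**: for `χ₁ ≫ χ₁ = -d₁` on `X₁` and a ring
homomorphism `j : End⁰(X₁) →+* End⁰(X₂)` there are `φ : X₂ ⟶ X₂` and `M ≥ 1` with `φ ≫ φ = -(M²d₁)`,
`(Mχ₁) ≫ (Mχ₁) = -(M²d₁)` and `φ = M · j(χ₁)` in `End⁰(X₂)` (write `j(χ₁) = M⁻¹ · φ` with `φ ∈ End(X₂)`,
`End(X₂) ↪ End⁰(X₂) = End(X₂) ⊗ ℚ` — Mumford §19 Thm. 3, the tree's `endAlgebra.exists_eq_algebraMap_mul_of`,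
`endAlgebra.of_injective_of_charZero`). [cite: MumfordAV1970, §19 Thm. 3 and Cor. 2] [cite: MoonenZarhin1999LowDim, §5 (5.3)] -/
theorem exists_hom_comp_self_eq_neg_of_ringHom {χ₁ : X₁ ⟶ X₁} {d₁ : ℕ}
    (hχ₁ : χ₁ ≫ χ₁ = -(d₁ • 𝟙 X₁)) (j : X₁.endAlgebra →+* X₂.endAlgebra) :
    ∃ (φ : X₂ ⟶ X₂) (M : ℕ), 0 < M ∧ φ ≫ φ = -((M ^ 2 * d₁) • 𝟙 X₂) ∧
      (M • χ₁) ≫ (M • χ₁) = -((M ^ 2 * d₁) • 𝟙 X₁) ∧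
      AbelianVariety.endAlgebra.of X₂ φ = (M : ℚ) • j (AbelianVariety.endAlgebra.of X₁ χ₁) := by
  obtain ⟨M, F, hM, hF⟩ := AbelianVariety.endAlgebra.exists_eq_algebraMap_mul_of (j (AbelianVariety.endAlgebra.of X₁ χ₁))
  have hMQ : (M : ℚ) ≠ 0 := Nat.cast_ne_zero.2 hM
  have hz : j (AbelianVariety.endAlgebra.of X₁ χ₁) * j (AbelianVariety.endAlgebra.of X₁ χ₁) = -(d₁ : X₂.endAlgebra) := by
    rw [← map_mul]
    set χ' : End X₁ := χ₁ with hχ'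
    have h : χ' * χ' = -(d₁ • (1 : End X₁)) := hχ₁
    rw [← map_mul, h, map_neg, map_nsmul, map_one, map_neg, map_nsmul, map_one, nsmul_eq_mul, mul_one]
  have hofF : AbelianVariety.endAlgebra.of X₂ F = (M : ℚ) • j (AbelianVariety.endAlgebra.of X₁ χ₁) := by
    rw [hF, Algebra.algebraMap_eq_smul_one, smul_mul_assoc, one_mul, smul_smul, mul_inv_cancel₀ hMQ, one_smul]
  have hF2 : AbelianVariety.endAlgebra.of X₂ (F * F) = AbelianVariety.endAlgebra.of X₂ (-((M ^ 2 * d₁) • 1)) := by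
    rw [map_mul, hofF, smul_mul_smul_comm, hz, map_neg, map_nsmul, map_one, smul_neg, nsmul_eq_mul, mul_one,
      Nat.cast_mul, Nat.cast_pow, Algebra.smul_def, map_mul, map_natCast, sq]
  have hFF : F * F = -((M ^ 2 * d₁) • 1) := AbelianVariety.endAlgebra.of_injective_of_charZero (A := X₂) hF2
  refine ⟨F, M, Nat.pos_of_ne_zero hM, hFF, ?_, hofF⟩
  rw [Preadditive.nsmul_comp, Preadditive.comp_nsmul, hχ₁, smul_neg, smul_neg, smul_smul, smul_smul, sq]

/- **On path**: the Hodge conjecture gives every Hodge-conjecture statement here (the tree's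
`hodgeConjectureFor_prod_of_hodgeConjecture'`, not re-declared). -/
example (h : ∀ ⦃n : ℕ⦄ ⦃X : Motives.SchemeOver ℂ⦄, Motives.IsSmoothProjective n X → HodgeConjectureFor n X)
    (X₀ X₁ X₂ : AbelianVariety ℂ) : HodgeConjectureFor (X₀.prod (X₁.prod X₂)).dim (X₀.prod (X₁.prod X₂)).X :=
  hodgeConjectureFor_prod_of_hodgeConjecture' h X₀ (X₁.prod X₂)

end Literature.AlgebraicGeometry.HodgeTheory
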